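import Summits.Ventures.CertifiedArithmetic.LowPrec.GemmEnvelopeRowP5

/-!
# GEMM-level envelopes, part (h): row P5 for blocks of length 2 (pub-lowprec gemm gen 22, LXX-h)

HONEST FRAMING: certified error envelopes and provably optimal rounding/accumulation schemes for
low-precision formats under stated cost models; every table by two implementations; no hardware or
vendor claims.

`row_P5_fails_above` (`GemmEnvelopeRowP5`) settles row P5 beyond `θ = 258048/17` for MX blocks of length
`≥ 3` with the two-sided mask `(M, 0, v, …) · (0, M, v, …)`.  For blocks of LENGTH 2 a ONE-SIDED mask does the
same job: `a = (M, v)`, `b = (0, w)` with `M = 224 + μ` (pins the scale of `a` to `1`; its own product is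
masked by `b₀ = 0`), `v = (136/9 − μ)/1024 ↦ 1/64`, `w = 272 + μ ↦ 288` (pins the scale of `b` AND errs by
`≈ 1/17`): the only product is `v·w`, quantised to `288/64 = 9/2`, so `F1 = 9/(2 v w) − 1 > 35/289` iff
`v w < 2601/648`, which holds for every `μ > 0`; membership in `C(κ)` (`M ≤ κ v`) is exactly the condition of
the length-`≥ 3` witness, i.e. `κ > θ`.  THEOREM `row_P5_two_fails_above`: for `258048/17 < κ ≤ 28672`,
`MXC ≼ VEC-E4M3` FAILS on `C(κ)` with blocks of length 2.  Together with `row_P5_mxCeil_le_vecE4M3` (any block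
length, `κ ≤ θ`) and `row_P5_one_mxCeil_le_vecE4M3` (length 1, every `κ`) row P5 is decided for every block
length: tie iff (`k = 1` or `κ ≤ θ`).  (The length-2 mask was pointed out by the cell's idea-2 seat; an
unmasked crossed pair `(M, v) · (v, M)` only starts failing at `κ > 18432 = 272·1152/17`,
`row_P5_two_crossed_fails_above`, kept as a remark.)  Witness numbers by both pipelines, 0 diff:
`certs/gemm/GEMM-ENVELOPES-P5K2.json`. [cite: RouhaniEtAl2023MX, §5.1, §6.1]; [cite: MicikeviciusEtAl2022, §3]
-/

namespace Summit.Ventures.CertifiedArithmetic.LowPrec.GemmEnvelope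

open Finset
open Literature.ComputerArithmetic.FloatingPoint
open Literature.ComputerArithmetic.FloatingPoint.Format
open Literature.ComputerArithmetic.FloatingPoint.MiniFloat
open Literature.ComputerArithmetic.FloatingPoint.MXBlock
open Summit.Ventures.CertifiedArithmetic.LowPrec.SR

/-- **ROW P5 for blocks of length 2, `κ > 258048/17`**: `MXC ≼ VEC-E4M3` FAILS on `C(κ)` for
`258048/17 < κ ≤ 28672`: the per-vector datapath obeys `35/289`, while the one-sided masked MX block pair
`a = (M, v)`, `b = (0, w)` (`M = 224 + μ`, `v = (136/9 − μ)/1024`, `w = 272 + μ`,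
`μ = min (1/20) ((136 κ/9 − 229376)/(1024 + κ))`, numerators `M`, `w`) has scales `1`, `v ↦ 1/64`, `w ↦ 288`,
and relative GEMM error `9/(2 v w) − 1 > 35/289`. [cite: RouhaniEtAl2023MX, §5.1, §6.1] -/
theorem row_P5_two_fails_above {B : ℕ} (hB : 0 < B) {κ : ℚ} (hκ1 : 258048 / 17 < κ) (hκ2 : κ ≤ 28672) :
    ∃ q : ℚ, (∀ (a b : Fin B → Fin 2 → ℚ) (Aa Ab : ℚ),
        (∀ j i, |a j i| ≤ Aa ∧ (a j i = 0 ∨ Aa ≤ κ * |a j i|)) →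
        (∀ j i, |b j i| ≤ Ab ∧ (b j i = 0 ∨ Ab ≤ κ * |b j i|)) →
        |∑ j, ∑ i, (Aa / E4M3.maxRat * (roundNE E4M3 (a j i / (Aa / E4M3.maxRat))).toRat) *
            (Ab / E4M3.maxRat * (roundNE E4M3 (b j i / (Ab / E4M3.maxRat))).toRat)
            - ∑ j, ∑ i, a j i * b j i| ≤ q * ∑ j, ∑ i, |a j i * b j i|) ∧
      ∃ (a b : Fin B → Fin 2 → ℚ) (Aa Ab : ℚ),
        (∀ j i, |a j i| ≤ Aa ∧ (a j i = 0 ∨ Aa ≤ κ * |a j i|)) ∧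
        (∀ j i, |b j i| ≤ Ab ∧ (b j i = 0 ∨ Ab ≤ κ * |b j i|)) ∧
        q * ∑ j, ∑ i, |a j i * b j i| <
        |∑ j, ∑ i, (ceilScale E4M3 (a j) * (roundNE E4M3 (a j i / ceilScale E4M3 (a j))).toRat) *
            (ceilScale E4M3 (b j) * (roundNE E4M3 (b j i / ceilScale E4M3 (b j))).toRat)
            - ∑ j, ∑ i, a j i * b j i| := by
  have hM0 : 0 < E4M3.maxRat := by rw [e4m3_envelope_constants.2.2.2.2.2.1]; norm_num
  refine ⟨35 / 289, fun a b Aa Ab ha hb => vecE4M3_blocked_le a b hκ2 ha hb, ?_⟩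
  -- the witness parameters (as in `row_P5_fails_above`, plus `w = 272 + μ`)
  set μ : ℚ := min (1 / 20) ((κ * (136 / 9) - 229376) / (1024 + κ)) with hμdef
  have hκ0 : 0 < 1024 + κ := by linarith
  have hμpos : 0 < μ := lt_min (by norm_num) (div_pos (by linarith) hκ0)
  have hμle : μ ≤ 1 / 20 := min_le_left _ _
  have hμκ : μ * (1024 + κ) ≤ κ * (136 / 9) - 229376 := by
    have := min_le_right (1 / 20 : ℚ) ((κ * (136 / 9) - 229376) / (1024 + κ))
    rwa [le_div_iff₀ hκ0] at this
  set M : ℚ := 224 + μ with hMdef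
  set v : ℚ := (136 / 9 - μ) / 1024 with hvdef
  set w : ℚ := 272 + μ with hwdef
  have hMpos : 0 < M := by positivity
  have hwpos : 0 < w := by positivity
  have hv0 : 0 < v := by rw [hvdef]; apply div_pos _ (by norm_num); linarith
  have hv15 : 15 / 1024 < v := by rw [hvdef, lt_div_iff₀ (by norm_num : (0:ℚ) < 1024)]; linarith
  have hv16 : v ≤ 1 / 64 := by rw [hvdef, div_le_iff₀ (by norm_num : (0:ℚ) < 1024)]; linarith
  have hvM : v ≤ M := by linarith
  have hκv : M ≤ κ * v := by
    rw [hvdef, hMdef]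
    have : (224 + μ) * 1024 ≤ κ * (136 / 9 - μ) := by nlinarith
    rw [mul_div_assoc', le_div_iff₀ (by norm_num : (0:ℚ) < 1024)]
    linarith
  have hκM : M ≤ κ * M := by nlinarith
  have hκw : w ≤ κ * w := by nlinarith
  have h64 : (roundNE E4M3 v).toRat = 1 / 64 := toRat_roundNE_E4M3_eq_inv64 hv15 hv16
  have h288 : (roundNE E4M3 w).toRat = 288 := toRat_roundNE_E4M3_eq_288 (by linarith) (by linarith)
  -- the key inequality `v w < 2601/648` (`= (136/9)·272/1024`)
  have hvw : v * w < 2601 / 648 := by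
    rw [hvdef, hwdef]
    rw [div_mul_eq_mul_div, div_lt_iff₀ (by norm_num : (0:ℚ) < 1024)]
    nlinarith
  -- the blocks
  set a' : Fin 2 → ℚ := Fin.cases M (fun _ : Fin 1 => v) with ha'
  set b' : Fin 2 → ℚ := Fin.cases (0 : ℚ) (fun _ : Fin 1 => w) with hb'
  have ha0 : a' 0 = M := rfl
  have ha1 : a' 1 = v := rfl
  have hb0 : b' 0 = 0 := rfl
  have hb1 : b' 1 = w := rfl
  have haM : ∀ i, |a' i| ≤ M := by
    refine Fin.forall_fin_two.mpr ⟨?_, ?_⟩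
    · rw [ha0, abs_of_pos hMpos]
    · rw [ha1, abs_of_pos hv0]; exact hvM
  have hbw : ∀ i, |b' i| ≤ w := by
    refine Fin.forall_fin_two.mpr ⟨?_, ?_⟩
    · rw [hb0, abs_zero]; exact hwpos.le
    · rw [hb1, abs_of_pos hwpos]
  have hmemA : ∀ (j : Fin B) (i : Fin 2), |(fun _ : Fin B => a') j i| ≤ M ∧
      ((fun _ : Fin B => a') j i = 0 ∨ M ≤ κ * |(fun _ : Fin B => a') j i|) := by
    intro j i; refine ⟨haM i, ?_⟩
    show a' i = 0 ∨ M ≤ κ * |a' i|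
    revert i
    refine Fin.forall_fin_two.mpr ⟨?_, ?_⟩
    · rw [ha0, abs_of_pos hMpos]; exact Or.inr hκM
    · rw [ha1, abs_of_pos hv0]; exact Or.inr hκv
  have hmemB : ∀ (j : Fin B) (i : Fin 2), |(fun _ : Fin B => b') j i| ≤ w ∧
      ((fun _ : Fin B => b') j i = 0 ∨ w ≤ κ * |(fun _ : Fin B => b') j i|) := by
    intro j i; refine ⟨hbw i, ?_⟩
    show b' i = 0 ∨ w ≤ κ * |b' i|
    revert i
    refine Fin.forall_fin_two.mpr ⟨Or.inl hb0, ?_⟩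
    rw [hb1, abs_of_pos hwpos]; exact Or.inr hκw
  -- scales
  have hXa : ceilScale E4M3 a' = 1 := by
    have hBM : blockMax a' = M := blockMax_eq_of_forall_le haM (i₀ := 0) (by rw [ha0, abs_of_pos hMpos])
    have h := ceilScale_eq_zpow hM0 (V := a') (e := 0)
      (by rw [hBM, e4m3_envelope_constants.2.2.2.2.2.1]; norm_num; linarith)
      (by rw [hBM, e4m3_envelope_constants.2.2.2.2.2.1]; norm_num; linarith)
    simpa using h
  have hXb : ceilScale E4M3 b' = 1 := by
    have hBM : blockMax b' = w := blockMax_eq_of_forall_le hbw (i₀ := 1) (by rw [hb1, abs_of_pos hwpos])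
    have h := ceilScale_eq_zpow hM0 (V := b') (e := 0)
      (by rw [hBM, e4m3_envelope_constants.2.2.2.2.2.1]; norm_num; linarith)
      (by rw [hBM, e4m3_envelope_constants.2.2.2.2.2.1]; norm_num; linarith)
    simpa using h
  -- the three block sums
  have hS1 : ∑ i, (roundNE E4M3 (a' i)).toRat * (roundNE E4M3 (b' i)).toRat = 9 / 2 := by
    rw [Fin.sum_univ_two, ha0, ha1, hb0, hb1, h64, h288, toRat_roundNE_zero]; norm_num
  have hS2 : ∑ i, a' i * b' i = v * w := by
    rw [Fin.sum_univ_two, ha0, ha1, hb0, hb1]; ring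
  have hS3 : ∑ i, |a' i * b' i| = v * w := by
    rw [Fin.sum_univ_two, ha0, ha1, hb0, hb1, mul_zero, abs_zero, abs_of_pos (mul_pos hv0 hwpos)]; ring
  refine ⟨fun _ => a', fun _ => b', M, w, hmemA, hmemB, ?_⟩
  simp only [hXa, hXb, div_one, one_mul, hS1, hS2, hS3, sum_const, card_univ, Fintype.card_fin,
    nsmul_eq_mul]
  have hB' : (0 : ℚ) < (B : ℚ) := by exact_mod_cast hB
  have hcore : 35 / 289 * (v * w) < 9 / 2 - v * w := by linarith
  rw [abs_of_pos (by nlinarith [mul_lt_mul_of_pos_left hcore hB'])]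
  nlinarith [mul_lt_mul_of_pos_left hcore hB']

/-- Remark (unmasked crossed pairs): for `18432 < κ ≤ 28672` already the crossed MX block pair
`a = (M, v)`, `b = (v, M)` (`M = 272 + μ`, `μ = min (1/100) ((κ − 18432)/200)`, `v = max (M/κ) (1501/102400)`,
numerators `M`; scale `1`, `M ↦ 288`, `v ↦ 1/64`) violates the per-vector bound: relative GEMM error
`9/(2 M v) − 1 > 35/289` (`18432 = 648·272²/2601 = 272·1152/17`). [cite: RouhaniEtAl2023MX, §5.1, §6.1] -/
theorem row_P5_two_crossed_fails_above {B : ℕ} (hB : 0 < B) {κ : ℚ} (hκ1 : 18432 < κ)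
    (hκ2 : κ ≤ 28672) :
    ∃ q : ℚ, (∀ (a b : Fin B → Fin 2 → ℚ) (Aa Ab : ℚ),
        (∀ j i, |a j i| ≤ Aa ∧ (a j i = 0 ∨ Aa ≤ κ * |a j i|)) →
        (∀ j i, |b j i| ≤ Ab ∧ (b j i = 0 ∨ Ab ≤ κ * |b j i|)) →
        |∑ j, ∑ i, (Aa / E4M3.maxRat * (roundNE E4M3 (a j i / (Aa / E4M3.maxRat))).toRat) *
            (Ab / E4M3.maxRat * (roundNE E4M3 (b j i / (Ab / E4M3.maxRat))).toRat)
            - ∑ j, ∑ i, a j i * b j i| ≤ q * ∑ j, ∑ i, |a j i * b j i|) ∧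
      ∃ (a b : Fin B → Fin 2 → ℚ) (Aa Ab : ℚ),
        (∀ j i, |a j i| ≤ Aa ∧ (a j i = 0 ∨ Aa ≤ κ * |a j i|)) ∧
        (∀ j i, |b j i| ≤ Ab ∧ (b j i = 0 ∨ Ab ≤ κ * |b j i|)) ∧
        q * ∑ j, ∑ i, |a j i * b j i| <
        |∑ j, ∑ i, (ceilScale E4M3 (a j) * (roundNE E4M3 (a j i / ceilScale E4M3 (a j))).toRat) *
            (ceilScale E4M3 (b j) * (roundNE E4M3 (b j i / ceilScale E4M3 (b j))).toRat)
            - ∑ j, ∑ i, a j i * b j i| := by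
  have hM0 : 0 < E4M3.maxRat := by rw [e4m3_envelope_constants.2.2.2.2.2.1]; norm_num
  refine ⟨35 / 289, fun a b Aa Ab ha hb => vecE4M3_blocked_le a b hκ2 ha hb, ?_⟩
  have hκ0 : 0 < κ := by linarith
  -- the witness parameters
  set μ : ℚ := min (1 / 100) ((κ - 18432) / 200) with hμdef
  have hμpos : 0 < μ := lt_min (by norm_num) (div_pos (by linarith) (by norm_num))
  have hμle : μ ≤ 1 / 100 := min_le_left _ _
  have hμκ : μ * 200 ≤ κ - 18432 := by
    have := min_le_right (1 / 100 : ℚ) ((κ - 18432) / 200)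
    rwa [le_div_iff₀ (by norm_num : (0:ℚ) < 200)] at this
  set M : ℚ := 272 + μ with hMdef
  have hMpos : 0 < M := by positivity
  have hM272 : 272 < M := by linarith
  have hM273 : M ≤ 273 := by linarith
  set v : ℚ := max (M / κ) (1501 / 102400) with hvdef
  have hv15 : 15 / 1024 < v := lt_of_lt_of_le (by norm_num) (le_max_right _ _)
  have hv0 : 0 < v := by linarith
  have hMκ : M / κ ≤ 1 / 64 := by
    rw [div_le_iff₀ hκ0]; linarith
  have hv16 : v ≤ 1 / 64 := max_le hMκ (by norm_num)
  have hvM : v ≤ M := by linarith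
  have hκv : M ≤ κ * v := by
    have h1 : M / κ ≤ v := le_max_left _ _
    rwa [div_le_iff₀' hκ0] at h1
  have hκM : M ≤ κ * M := by nlinarith
  have h64 : (roundNE E4M3 v).toRat = 1 / 64 := toRat_roundNE_E4M3_eq_inv64 hv15 hv16
  have h288 : (roundNE E4M3 M).toRat = 288 := toRat_roundNE_E4M3_eq_288 hM272 (by linarith)
  -- the key inequality `M v < 2601/648`
  have hMv : M * v < 2601 / 648 := by
    rcases le_total (M / κ) (1501 / 102400) with h | h
    · rw [hvdef, max_eq_right h]; nlinarith
    · rw [hvdef, max_eq_left h]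
      have hμμ : μ * μ ≤ μ * (1 / 100) := mul_le_mul_of_nonneg_left hμle hμpos.le
      have hMM : 648 * (M * M) < 2601 * κ := by rw [hMdef]; nlinarith
      have : M * (M / κ) = M * M / κ := by ring
      rw [this, div_lt_iff₀ hκ0]; nlinarith
  -- the blocks
  set a' : Fin 2 → ℚ := Fin.cases M (fun _ : Fin 1 => v) with ha'
  set b' : Fin 2 → ℚ := Fin.cases v (fun _ : Fin 1 => M) with hb'
  have ha0 : a' 0 = M := rfl
  have ha1 : a' 1 = v := rfl
  have hb0 : b' 0 = v := rfl
  have hb1 : b' 1 = M := rfl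
  have haM : ∀ i, |a' i| ≤ M := by
    refine Fin.forall_fin_two.mpr ⟨?_, ?_⟩
    · rw [ha0, abs_of_pos hMpos]
    · rw [ha1, abs_of_pos hv0]; exact hvM
  have hbM : ∀ i, |b' i| ≤ M := by
    refine Fin.forall_fin_two.mpr ⟨?_, ?_⟩
    · rw [hb0, abs_of_pos hv0]; exact hvM
    · rw [hb1, abs_of_pos hMpos]
  have hmemA : ∀ (j : Fin B) (i : Fin 2), |(fun _ : Fin B => a') j i| ≤ M ∧
      ((fun _ : Fin B => a') j i = 0 ∨ M ≤ κ * |(fun _ : Fin B => a') j i|) := by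
    intro j i; refine ⟨haM i, ?_⟩
    show a' i = 0 ∨ M ≤ κ * |a' i|
    revert i
    refine Fin.forall_fin_two.mpr ⟨?_, ?_⟩
    · rw [ha0, abs_of_pos hMpos]; exact Or.inr hκM
    · rw [ha1, abs_of_pos hv0]; exact Or.inr hκv
  have hmemB : ∀ (j : Fin B) (i : Fin 2), |(fun _ : Fin B => b') j i| ≤ M ∧
      ((fun _ : Fin B => b') j i = 0 ∨ M ≤ κ * |(fun _ : Fin B => b') j i|) := by
    intro j i; refine ⟨hbM i, ?_⟩
    show b' i = 0 ∨ M ≤ κ * |b' i|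
    revert i
    refine Fin.forall_fin_two.mpr ⟨?_, ?_⟩
    · rw [hb0, abs_of_pos hv0]; exact Or.inr hκv
    · rw [hb1, abs_of_pos hMpos]; exact Or.inr hκM
  -- scales
  have hXa : ceilScale E4M3 a' = 1 := by
    have hBM : blockMax a' = M := blockMax_eq_of_forall_le haM (i₀ := 0) (by rw [ha0, abs_of_pos hMpos])
    have h := ceilScale_eq_zpow hM0 (V := a') (e := 0)
      (by rw [hBM, e4m3_envelope_constants.2.2.2.2.2.1]; norm_num; linarith)
      (by rw [hBM, e4m3_envelope_constants.2.2.2.2.2.1]; norm_num; linarith)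
    simpa using h
  have hXb : ceilScale E4M3 b' = 1 := by
    have hBM : blockMax b' = M := blockMax_eq_of_forall_le hbM (i₀ := 1) (by rw [hb1, abs_of_pos hMpos])
    have h := ceilScale_eq_zpow hM0 (V := b') (e := 0)
      (by rw [hBM, e4m3_envelope_constants.2.2.2.2.2.1]; norm_num; linarith)
      (by rw [hBM, e4m3_envelope_constants.2.2.2.2.2.1]; norm_num; linarith)
    simpa using h
  -- the three block sums
  have hS1 : ∑ i, (roundNE E4M3 (a' i)).toRat * (roundNE E4M3 (b' i)).toRat = 9 := by
    rw [Fin.sum_univ_two, ha0, ha1, hb0, hb1, h64, h288]; norm_num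
  have hS2 : ∑ i, a' i * b' i = 2 * (M * v) := by
    rw [Fin.sum_univ_two, ha0, ha1, hb0, hb1]; ring
  have hS3 : ∑ i, |a' i * b' i| = 2 * (M * v) := by
    rw [Fin.sum_univ_two, ha0, ha1, hb0, hb1, abs_of_pos (mul_pos hMpos hv0),
      abs_of_pos (mul_pos hv0 hMpos)]; ring
  refine ⟨fun _ => a', fun _ => b', M, M, hmemA, hmemB, ?_⟩
  simp only [hXa, hXb, div_one, one_mul, hS1, hS2, hS3, sum_const, card_univ, Fintype.card_fin,
    nsmul_eq_mul]
  have hB' : (0 : ℚ) < (B : ℚ) := by exact_mod_cast hB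
  have hcore : 35 / 289 * (2 * (M * v)) < 9 - 2 * (M * v) := by linarith
  rw [abs_of_pos (by nlinarith [mul_lt_mul_of_pos_left hcore hB'])]
  nlinarith [mul_lt_mul_of_pos_left hcore hB']

end Summit.Ventures.CertifiedArithmetic.LowPrec.GemmEnvelope
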